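import Summits.CriticalPhenomena.SAWScalingLimit.Theses.SAWRestrictionRigidity
import Literature.Probability.RandomPlanarGeometry.ConformalMapRiemannProofs
import Literature.Probability.RandomPlanarGeometry.ConformalMapCaratheodoryProofs
import Literature.Probability.RandomPlanarGeometry.JordanDomainProofs
import Literature.Probability.RandomPlanarGeometry.ConformalRectangleProofs

/-!
# Stub `stub_closureHomeomorph` of line `registered` (scalar / avoidance-cocycle cut), crux `Rigidity` (stmt-CriticalPhenomena-1368), route SAWRestrictionRigidity

Target: `Summits/CriticalPhenomena/SAWScalingLimit/Theorems/SAWRestrictionRigidityRigidityClosureHomeomorph.lean` (`--supports stmt-CriticalPhenomena-1368`).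

A continuous plane map `Φ` agreeing on a Jordan domain `D` with a conformal equivalence
`g : D → D₂` onto a Jordan domain is a homeomorphism of `closure D` onto `closure D₂` carrying
`D`, `∂D` onto `D₂`, `∂D₂`, and it takes the boundary values of `g` at boundary points. Proof:
by the Riemann mapping theorem (`exists_conformalEquiv_ball_holds`) and Carathéodory's theorem
(`JordanDomain.exists_continuousOn_extension_holds`, both proved in the tree) the conformal maps
`ψ₁ : 𝔻 → D` and `ψ₂ = g ∘ ψ₁ : 𝔻 → D₂` extend to continuous bijections `Φ₁ : 𝔻̄ → D̄`,
`Φ₂ : 𝔻̄ → D̄₂` (circle onto the frontiers); `Φ ∘ Φ₁ = Φ₂` on `𝔻`, hence on `𝔻̄` by continuity,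
and everything is read off. The inverse is continuous as the inverse of a continuous bijection
of a compact set (`continuousOn_invFunOn_of_isCompact`).

References: Ch. Pommerenke, *Boundary Behaviour of Conformal Maps* (1992), Thm. 2.6;
L. V. Ahlfors, *Complex Analysis* (1979), Ch. 6 §1.1 Thm. 1.
-/

noncomputable section

namespace Summit.CriticalPhenomena.SAWScalingLimit.Cruxes.Rigidity.Cocycle

open MeasureTheory Set Filter Topology
open Literature.Probability.RandomPlanarGeometry

/-- **Closure homeomorphism of a conformal equivalence of Jordan domains** (stub 2 of line `registered`, crux `Rigidity`): a continuous plane map agreeing on `D` with a conformal equivalence `g : D → D₂` having the marked points as boundary values is injective on `closure D`, maps `D`, `closure D`, `frontier D` onto `D₂`, `closure D₂`, `frontier D₂` and marks to marks; its inverse on `closure D` is continuous on `closure D₂` and extends `g.symm` (Riemann mapping theorem + Carathéodory's theorem, Pommerenke 1992 Thm. 2.6). [cite: PommerenkeBBCM1992, Thm. 2.6] -/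
theorem stub_closureHomeomorph : ∀ (D D₂ : Literature.Probability.RandomPlanarGeometry.DobrushinDomain) (g : Literature.Probability.RandomPlanarGeometry.ConformalEquiv D.carrier D₂.carrier) (Φ : C(ℂ, ℂ)), g.HasBoundaryValue (D.pt 0) (D₂.pt 0) → g.HasBoundaryValue (D.pt 1) (D₂.pt 1) → Set.EqOn Φ g D.carrier → Set.InjOn Φ (closure D.carrier) ∧ Φ '' D.carrier = D₂.carrier ∧ Φ '' closure D.carrier = closure D₂.carrier ∧ Φ '' frontier D.carrier = frontier D₂.carrier ∧ Φ (D.pt 0) = D₂.pt 0 ∧ Φ (D.pt 1) = D₂.pt 1 ∧ ContinuousOn (Function.invFunOn Φ (closure D.carrier)) (closure D₂.carrier) ∧ Set.EqOn (Function.invFunOn Φ (closure D.carrier)) g.symm D₂.carrier := by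
  intro D D₂ g Φ h0 h1 hΦg
  -- Riemann maps of the disc onto `D` and `D₂` (the second one through `g`)
  obtain ⟨φ⟩ := exists_conformalEquiv_ball_holds (U := D.carrier) D.isOpen
    D.toJordanDomain.isSimplyConnected_carrier D.toJordanDomain.carrier_ne_univ
  set ψ₁ : ConformalEquiv (Metric.ball (0 : ℂ) 1) D.carrier := φ.symm
  set ψ₂ : ConformalEquiv (Metric.ball (0 : ℂ) 1) D₂.carrier := ψ₁.trans g
  -- their Carathéodory extensions
  obtain ⟨Φ₁, hΦ₁c, hΦ₁e, hΦ₁bij, hΦ₁bij'⟩ :=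
    JordanDomain.exists_continuousOn_extension_holds D.toJordanDomain ψ₁
  obtain ⟨Φ₂, hΦ₂c, hΦ₂e, hΦ₂bij, hΦ₂bij'⟩ :=
    JordanDomain.exists_continuousOn_extension_holds D₂.toJordanDomain ψ₂
  -- `Φ ∘ Φ₁ = Φ₂` on the open disc, hence on the closed disc
  have hball : EqOn (Φ ∘ Φ₁) Φ₂ (Metric.ball 0 1) := by
    intro x hx
    rw [Function.comp_apply, hΦ₁e hx, hΦg (ψ₁.mapsTo hx), hΦ₂e hx, ConformalEquiv.trans_apply]
  have hcl : EqOn (Φ ∘ Φ₁) Φ₂ (Metric.closedBall 0 1) :=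
    hball.of_subset_closure (Φ.continuous.comp_continuousOn hΦ₁c) hΦ₂c
      Metric.ball_subset_closedBall (by rw [closure_ball (0 : ℂ) one_ne_zero])
  -- injectivity on the closure
  have hinj : InjOn Φ (closure D.carrier) := by
    rw [← hΦ₁bij.image_eq]
    exact ((hcl.injOn_iff).2 hΦ₂bij.injOn).image_of_comp
  -- images
  have himD : Φ '' D.carrier = D₂.carrier := by rw [hΦg.image_eq, g.bijOn.image_eq]
  have himcl : Φ '' closure D.carrier = closure D₂.carrier := by
    rw [← hΦ₁bij.image_eq, image_image, ← hΦ₂bij.image_eq]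
    exact hcl.image_eq
  have himfr : Φ '' frontier D.carrier = frontier D₂.carrier := by
    rw [← hΦ₁bij'.image_eq, image_image, ← hΦ₂bij'.image_eq]
    exact (hcl.mono Metric.sphere_subset_closedBall).image_eq
  -- marks
  have hpt0 : Φ (D.pt 0) = D₂.pt 0 :=
    g.eq_of_hasBoundaryValue_of_eqOn hΦg (frontier_subset_closure (D.pt_mem_frontier 0)) h0
  have hpt1 : Φ (D.pt 1) = D₂.pt 1 :=
    g.eq_of_hasBoundaryValue_of_eqOn hΦg (frontier_subset_closure (D.pt_mem_frontier 1)) h1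
  -- the inverse
  have hbij : BijOn Φ (closure D.carrier) (closure D₂.carrier) := himcl ▸ hinj.bijOn_image
  have hcont : ContinuousOn (Function.invFunOn Φ (closure D.carrier)) (closure D₂.carrier) :=
    continuousOn_invFunOn_of_isCompact D.isBounded.isCompact_closure Φ.continuous.continuousOn hbij
  have hsymm : EqOn (Function.invFunOn Φ (closure D.carrier)) g.symm D₂.carrier := by
    intro w hw
    have hz : g.symm w ∈ D.carrier := g.symm_mapsTo hw
    have hw' : Φ (g.symm w) = w := by rw [hΦg hz, g.apply_symm_apply hw]
    conv_lhs => rw [← hw']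
    exact hinj.leftInvOn_invFunOn (subset_closure hz)
  exact ⟨hinj, himD, himcl, himfr, hpt0, hpt1, hcont, hsymm⟩

end Summit.CriticalPhenomena.SAWScalingLimit.Cruxes.Rigidity.Cocycle

end
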